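import Mathlib
import Summits.ValiantsHypothesis.ValiantsHypothesis.Theses.GeneratorObstructions
import Summits.ValiantsHypothesis.ValiantsHypothesis.Theorems.GeneratorObstructionsPowGenDegreeQPRowOne

/-!
# K2 `PowGenDegreeQP` (stmt-ValiantsHypothesis-11655), line `trace-side-regimes`:
# K2 and both registered stubs are equivalent to their restrictions to the rows `m ≥ 2`

Helper file (`--supports stmt-ValiantsHypothesis-11655`).  The row `m = 1` of the window is closed
(`…PowGenDegreeQPRowOne`: `powGenDegreeQP_rowOne`, `stub_sliceGen_rowOne`, `stub_wideGen_rowOne`,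
for EVERY exponent `c₀`), so the route decl `PowGenDegreeQP` and the registered stubs `stub_sliceGen`,
`stub_wideGen` of `Cruxes/GenFlipThesis/Lines/trace_side_regimes.lean` are each EQUIVALENT to the
same statement with the hypothesis `1 ≤ m` strengthened to `2 ≤ m`:
`powGenDegreeQP_iff_two_le`, `stub_sliceGen_iff_two_le`, `stub_wideGen_iff_two_le` (verbatim bodies
on both sides).  A lead may therefore replace either stub by its `2 ≤ m` form without loss.

Honest label: bookkeeping on the closed bottom row; rows `m ≥ 2` OPEN (row `m = 2` reduced to two
classical inputs in `…PowGenDegreeQPRowTwoReduction`).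
-/

namespace Summit.ValiantsHypothesis.ValiantsHypothesis.Theorems.GeneratorObstructions.PowGenDegreeQP

open MvPolynomial
open Literature.NumberTheory.DiophantineGeometry Literature.Computability.AlgebraicComplexity
open Summit.ValiantsHypothesis.ValiantsHypothesis.Theses.GeneratorObstructions

-- `Summit.ValiantsHypothesis.ValiantsHypothesis.…` is the tree's mandated single-conjunct layout.
set_option linter.dupNamespace false

noncomputable section

/-- **K2 ⟺ K2 on the rows `m ≥ 2`.** The route decl `PowGenDegreeQP` (verbatim) is equivalent to
the same window statement with `2 ≤ m` in place of `1 ≤ m`, the row `m = 1` being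
`powGenDegreeQP_rowOne`. [folklore] -/
theorem powGenDegreeQP_iff_two_le :
    PowGenDegreeQP ↔
      ∀ c : ℕ, ∃ c₀ : ℕ, ∀ m e : ℕ, 2 ≤ m → m + e ≤ 2 ^ ((Nat.log 2 m + c) ^ c) →
        ∀ χ : Weight (MatIdx (m + e)),
          Module.finrank ℂ (↥(highestWeightSpace (orbitCoordRep (powFormLex ℂ (m + e) m) m) χ) ⧸
            Submodule.comap (highestWeightSpace (orbitCoordRep (powFormLex ℂ (m + e) m) m) χ).subtype
              (⨆ p : Weight (MatIdx (m + e)) × Weight (MatIdx (m + e)),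
                ⨆ (_ : p.1 + p.2 = χ ∧ p.1 ≠ 0 ∧ p.2 ≠ 0),
                  highestWeightSpace (orbitCoordRep (powFormLex ℂ (m + e) m) m) p.1 *
                    highestWeightSpace (orbitCoordRep (powFormLex ℂ (m + e) m) m) p.2)) ≠ 0 →
          -(Weight.size χ) ≤ (m : ℤ) * 2 ^ ((Nat.log 2 m + c₀) ^ c₀) := by
  unfold PowGenDegreeQP
  constructor
  · intro h c
    obtain ⟨c₀, hc₀⟩ := h c
    exact ⟨c₀, fun m e hm he χ hγ => hc₀ m e (by omega) he χ hγ⟩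
  · intro h c
    obtain ⟨c₀, hc₀⟩ := h c
    refine ⟨c₀, fun m e hm he χ hγ => ?_⟩
    rcases Nat.lt_or_ge m 2 with hm2 | hm2
    · obtain rfl : m = 1 := by omega
      exact powGenDegreeQP_rowOne c₀ e χ hγ
    · exact hc₀ m e hm2 he χ hγ

/-- **`stub_sliceGen` ⟺ `stub_sliceGen` on the rows `m ≥ 2`** (registered stub of
`Lines/trace_side_regimes.lean`, verbatim body; row `m = 1` by `stub_sliceGen_rowOne`). [folklore] -/
theorem stub_sliceGen_iff_two_le :
    (∀ c : ℕ, ∃ c₀ : ℕ, ∀ m e : ℕ, 1 ≤ m → m + e ≤ 2 ^ ((Nat.log 2 m + c) ^ c) →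
      ∀ ι : MatIdx m → MatIdx (m + e), StrictMono ι → IsUpperSet (Set.range ι) →
        ∀ χ : Weight (MatIdx m),
          Module.finrank ℂ (↥(highestWeightSpace (orbitCoordRep (powFormLex ℂ (m + e) m) m) (Function.extend ι χ 0)) ⧸ Submodule.comap (highestWeightSpace (orbitCoordRep (powFormLex ℂ (m + e) m) m) (Function.extend ι χ 0)).subtype (⨆ p : Weight (MatIdx (m + e)) × Weight (MatIdx (m + e)), ⨆ (_ : p.1 + p.2 = (Function.extend ι χ 0) ∧ p.1 ≠ 0 ∧ p.2 ≠ 0), highestWeightSpace (orbitCoordRep (powFormLex ℂ (m + e) m) m) p.1 * highestWeightSpace (orbitCoordRep (powFormLex ℂ (m + e) m) m) p.2)) ≠ 0 →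
            -(Weight.size χ) ≤ (m : ℤ) * 2 ^ ((Nat.log 2 m + c₀) ^ c₀)) ↔
    (∀ c : ℕ, ∃ c₀ : ℕ, ∀ m e : ℕ, 2 ≤ m → m + e ≤ 2 ^ ((Nat.log 2 m + c) ^ c) →
      ∀ ι : MatIdx m → MatIdx (m + e), StrictMono ι → IsUpperSet (Set.range ι) →
        ∀ χ : Weight (MatIdx m),
          Module.finrank ℂ (↥(highestWeightSpace (orbitCoordRep (powFormLex ℂ (m + e) m) m) (Function.extend ι χ 0)) ⧸ Submodule.comap (highestWeightSpace (orbitCoordRep (powFormLex ℂ (m + e) m) m) (Function.extend ι χ 0)).subtype (⨆ p : Weight (MatIdx (m + e)) × Weight (MatIdx (m + e)), ⨆ (_ : p.1 + p.2 = (Function.extend ι χ 0) ∧ p.1 ≠ 0 ∧ p.2 ≠ 0), highestWeightSpace (orbitCoordRep (powFormLex ℂ (m + e) m) m) p.1 * highestWeightSpace (orbitCoordRep (powFormLex ℂ (m + e) m) m) p.2)) ≠ 0 →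
            -(Weight.size χ) ≤ (m : ℤ) * 2 ^ ((Nat.log 2 m + c₀) ^ c₀)) := by
  constructor
  · intro h c
    obtain ⟨c₀, hc₀⟩ := h c
    exact ⟨c₀, fun m e hm he ι hι hup χ hγ => hc₀ m e (by omega) he ι hι hup χ hγ⟩
  · intro h c
    obtain ⟨c₀, hc₀⟩ := h c
    refine ⟨c₀, fun m e hm he ι hι hup χ hγ => ?_⟩
    rcases Nat.lt_or_ge m 2 with hm2 | hm2
    · obtain rfl : m = 1 := by omega
      exact stub_sliceGen_rowOne c₀ e ι hι χ hγ
    · exact hc₀ m e hm2 he ι hι hup χ hγ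

/-- **`stub_wideGen` ⟺ `stub_wideGen` on the rows `m ≥ 2`** (registered stub of
`Lines/trace_side_regimes.lean`, verbatim body; the wide regime is empty in the row `m = 1`,
`stub_wideGen_rowOne`). [folklore] -/
theorem stub_wideGen_iff_two_le :
    (∀ c : ℕ, ∃ c₀ : ℕ, ∀ m e : ℕ, 1 ≤ m → m + e ≤ 2 ^ ((Nat.log 2 m + c) ^ c) →
      ∀ ι : MatIdx m → MatIdx (m + e), StrictMono ι → IsUpperSet (Set.range ι) →
        ∀ χ : Weight (MatIdx (m + e)), (∃ x, x ∉ Set.range ι ∧ χ x ≠ 0) →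
          Module.finrank ℂ (↥(highestWeightSpace (orbitCoordRep (powFormLex ℂ (m + e) m) m) (χ)) ⧸ Submodule.comap (highestWeightSpace (orbitCoordRep (powFormLex ℂ (m + e) m) m) (χ)).subtype (⨆ p : Weight (MatIdx (m + e)) × Weight (MatIdx (m + e)), ⨆ (_ : p.1 + p.2 = (χ) ∧ p.1 ≠ 0 ∧ p.2 ≠ 0), highestWeightSpace (orbitCoordRep (powFormLex ℂ (m + e) m) m) p.1 * highestWeightSpace (orbitCoordRep (powFormLex ℂ (m + e) m) m) p.2)) ≠ 0 →
            -(Weight.size χ) ≤ (m : ℤ) * 2 ^ ((Nat.log 2 m + c₀) ^ c₀)) ↔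
    (∀ c : ℕ, ∃ c₀ : ℕ, ∀ m e : ℕ, 2 ≤ m → m + e ≤ 2 ^ ((Nat.log 2 m + c) ^ c) →
      ∀ ι : MatIdx m → MatIdx (m + e), StrictMono ι → IsUpperSet (Set.range ι) →
        ∀ χ : Weight (MatIdx (m + e)), (∃ x, x ∉ Set.range ι ∧ χ x ≠ 0) →
          Module.finrank ℂ (↥(highestWeightSpace (orbitCoordRep (powFormLex ℂ (m + e) m) m) (χ)) ⧸ Submodule.comap (highestWeightSpace (orbitCoordRep (powFormLex ℂ (m + e) m) m) (χ)).subtype (⨆ p : Weight (MatIdx (m + e)) × Weight (MatIdx (m + e)), ⨆ (_ : p.1 + p.2 = (χ) ∧ p.1 ≠ 0 ∧ p.2 ≠ 0), highestWeightSpace (orbitCoordRep (powFormLex ℂ (m + e) m) m) p.1 * highestWeightSpace (orbitCoordRep (powFormLex ℂ (m + e) m) m) p.2)) ≠ 0 →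
            -(Weight.size χ) ≤ (m : ℤ) * 2 ^ ((Nat.log 2 m + c₀) ^ c₀)) := by
  constructor
  · intro h c
    obtain ⟨c₀, hc₀⟩ := h c
    exact ⟨c₀, fun m e hm he ι hι hup χ hw hγ => hc₀ m e (by omega) he ι hι hup χ hw hγ⟩
  · intro h c
    obtain ⟨c₀, hc₀⟩ := h c
    refine ⟨c₀, fun m e hm he ι hι hup χ hw hγ => ?_⟩
    rcases Nat.lt_or_ge m 2 with hm2 | hm2
    · obtain rfl : m = 1 := by omega
      exact stub_wideGen_rowOne c₀ e ι hup χ hw hγ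
    · exact hc₀ m e hm2 he ι hι hup χ hw hγ

/-- **K2 from its rows `m ≥ 2`** (the usable direction, as an implication). [folklore] -/
theorem powGenDegreeQP_of_two_le
    (h : ∀ c : ℕ, ∃ c₀ : ℕ, ∀ m e : ℕ, 2 ≤ m → m + e ≤ 2 ^ ((Nat.log 2 m + c) ^ c) →
        ∀ χ : Weight (MatIdx (m + e)),
          Module.finrank ℂ (↥(highestWeightSpace (orbitCoordRep (powFormLex ℂ (m + e) m) m) χ) ⧸
            Submodule.comap (highestWeightSpace (orbitCoordRep (powFormLex ℂ (m + e) m) m) χ).subtype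
              (⨆ p : Weight (MatIdx (m + e)) × Weight (MatIdx (m + e)),
                ⨆ (_ : p.1 + p.2 = χ ∧ p.1 ≠ 0 ∧ p.2 ≠ 0),
                  highestWeightSpace (orbitCoordRep (powFormLex ℂ (m + e) m) m) p.1 *
                    highestWeightSpace (orbitCoordRep (powFormLex ℂ (m + e) m) m) p.2)) ≠ 0 →
          -(Weight.size χ) ≤ (m : ℤ) * 2 ^ ((Nat.log 2 m + c₀) ^ c₀)) :
    PowGenDegreeQP :=
  powGenDegreeQP_iff_two_le.mpr h

end

end Summit.ValiantsHypothesis.ValiantsHypothesis.Theorems.GeneratorObstructions.PowGenDegreeQP
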